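import Literature.Topology.FourManifolds.TorusCurveTubes
import Literature.Geometry.Manifold.SmoothEmbeddingInverse
import HarnessLib

/-!
# Torus tubes `γ × c′` in `F × T²`: the Lagrangian tori of Akhmedov–Park in tube coordinates

Topic `Literature/Topology/FourManifolds` (fact seat of the Seiberg–Witten leaf
`Literature.Barriers.SmoothPoincare4.akhmedovPark2010_lemma8_invariants`; block 1 of
Akhmedov–Park's `X₁(m)`: A. Akhmedov, B. D. Park, Invent. Math. 181 (2010), §2 and §9 eq. (9.1),
the four Luttinger surgery tori `a₁′ × c′, b₁′ × c″, a₂′ × c′, a₂″ × d′ ⊂ Σ₂ × T²`, products of a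
curve `γ ⊂ Σ₂` with a circle `c = S¹ × {pt}` or `d = {pt} × S¹` of `T²`, "disjoint from
`Σ₂ × (½, ½)`").

Setting.  `F` is a closed smooth surface (charted on `ℝ²`), `P = (F × S¹) × S¹` Mathlib's product
manifold, and `X` any smooth `4`-manifold charted on `ℝ⁴` with a homeomorphism `e : X ≃ₜ P`
smooth in both directions (the recharted model of `exists_surface_prod_torus_smooth_model`,
`SurfaceTimesTorusTube.lean`).  A **curve tube** is a smooth embedding `γ : S¹ × ℝ¹ → F` with
open range (e.g. the horizontal circles of a torus summand, `TorusCurveTubes.lean`), the surgery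
torus `S¹ × S¹` is recharted on `ℝ²` along `f₂` (`Rechart f₂ (Circle × Circle)`, hypotheses
`hf₂`, `hf₂'`), and `θ ∈ S¹` is the centre of the quarter arc thickening the circle
`c′ = S¹ × {θ}` of `T²` (`CircleQuarterArcs.lean`).  The **torus tube of `γ × c′`** is

  `TT (w, p) = e⁻¹ ((γ (z₁, p₀), z₂), θ · exp(i arctan(p₁)/2))`,  `(z₁, z₂) = out₂ w`,

the torus `γ(S¹ × 0) × (S¹ × {θ})` thickened by the normal coordinate `p₀` of `γ` in `F` and the
arc coordinate `p₁` in the second circle factor; the first circle factor `z₂` of `T²` is the `c`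
direction of the torus, `z₁` the `γ` direction.

* `isSmoothEmbedding_torusTube` — **`TT` is a smooth embedding `(Rechart f₂ (S¹ × S¹)) × ℝ² → X`
  for the models `(𝓡 2).prod (𝓡 2) → 𝓡 4` with open range
  `{x | (e x).1.1 ∈ range γ ∧ Re((e x).2 θ⁻¹) > 0 ∧ Re(((e x).2 θ⁻¹)²) > 0}`** — the shape of tube
  consumed by `exists_tube_function`, `TubeRegluing.lean` and
  `Literature.Barriers.SmoothPoincare4.akhmedovPark2010_lemma8_rotation_block_step`
  (`isSmoothEmbedding_of_leftInverse_of_isOpenMap` with the left inverse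
  `x ↦ (into₂ ((γ⁻¹ (e x).1.1).1, (e x).1.2), ((γ⁻¹ (e x).1.1).2, Im w²/Re w²))`, `w = (e x).2 θ⁻¹`,
  smooth on the range by `contMDiffOn_invFun_range` for `γ`);
* `continuous_swapCircles`, `contMDiff_swapCircles` — the swap `((a, u), v) ↦ ((a, v), u)` of
  the two circle coordinates of `P` (an involutive diffeomorphism), through which the tori
  `γ × d′`, `d′ = {θ} × S¹`, are the tori `γ × c′` of the model `e.trans swap` (apply
  `isSmoothEmbedding_torusTube` to `e.trans swap`, whose smoothness both ways follows from
  `contMDiff_swapCircles`).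

Everything is proved; no definitions (the maps are bare expressions).

## References

* A. Akhmedov, B. D. Park, Invent. Math. 181 (2010), §2, §9 eq. (9.1). [AkhmedovPark2010]
* J. M. Lee, *Introduction to Smooth Manifolds* (2013), Prop. 5.2. [LeeSmoothManifolds2013]
-/

noncomputable section

open scoped Manifold ContDiff Topology
open Set Function
open Literature.Geometry.Manifold (Rechart)

namespace Literature.Topology.FourManifolds

/-! ### The swap of the two circle coordinates of `(F × S¹) × S¹` -/

section Swap

variable {F : Type*} [TopologicalSpace F]

/-- The swap `((a, u), v) ↦ ((a, v), u)` of the two circle coordinates is continuous. [folklore] -/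
theorem continuous_swapCircles :
    Continuous fun y : (F × Circle) × Circle => (((y.1.1, y.2) : F × Circle), y.1.2) := by
  fun_prop

/-- The swap of the two circle coordinates is smooth for the product model. [folklore] -/
theorem contMDiff_swapCircles [ChartedSpace (EuclideanSpace ℝ (Fin 2)) F] :
    ContMDiff (((𝓡 2).prod (𝓡 1)).prod (𝓡 1)) (((𝓡 2).prod (𝓡 1)).prod (𝓡 1)) ∞
      fun y : (F × Circle) × Circle => (((y.1.1, y.2) : F × Circle), y.1.2) :=
  ((contMDiff_fst.comp contMDiff_fst).prodMk contMDiff_snd).prodMk (contMDiff_snd.comp contMDiff_fst)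

end Swap

/-! ### The torus tube of `γ × c′` -/

section TorusTube

variable {F : Type} [TopologicalSpace F] [ChartedSpace (EuclideanSpace ℝ (Fin 2)) F]
  {X : Type} [TopologicalSpace X] [ChartedSpace (EuclideanSpace ℝ (Fin 4)) X]
  {f₂ : ModelProd (EuclideanSpace ℝ (Fin 1)) (EuclideanSpace ℝ (Fin 1)) ≃ₜ EuclideanSpace ℝ (Fin 2)}
  {γ : Circle × EuclideanSpace ℝ (Fin 1) → F}

/-- **The torus tube of `γ × c′` is a smooth embedding with open range.**  See the module
docstring: `F` a closed surface, `e : X ≃ₜ (F × S¹) × S¹` smooth both ways, `γ : S¹ × ℝ¹ → F` a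
curve tube, `θ` the centre of the arc; the tube
`TT (w, p) = e⁻¹ ((γ (z₁, p₀), z₂), θ · exp(i arctan(p₁)/2))`, `(z₁, z₂) = out₂ w`, of the torus
`γ × c′` is a smooth embedding `(Rechart f₂ (S¹ × S¹)) × ℝ² → X` for `(𝓡 2).prod (𝓡 2) → 𝓡 4`
with open range `{x | (e x).1.1 ∈ range γ ∧ Re((e x).2 θ⁻¹) > 0 ∧ Re(((e x).2 θ⁻¹)²) > 0}`.
(Akhmedov–Park 2010, §2 and §9 eq. (9.1): the tori `a₁′ × c′`, `b₁′ × c″`, `a₂′ × c′` of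
`Σ₂ × T²`.) [cite: AkhmedovPark2010, §2 and §9 eq. (9.1)] [cite: LeeSmoothManifolds2013, Prop. 5.2] -/
theorem isSmoothEmbedding_torusTube [IsManifold (𝓡 4) ∞ X]
    (hf₂ : ContMDiff ((𝓡 1).prod (𝓡 1)) 𝓘(ℝ, EuclideanSpace ℝ (Fin 2)) ∞ f₂)
    (hf₂' : ContMDiff 𝓘(ℝ, EuclideanSpace ℝ (Fin 2)) ((𝓡 1).prod (𝓡 1)) ∞ f₂.symm)
    (hγ : Manifold.IsSmoothEmbedding ((𝓡 1).prod (𝓡 1)) (𝓡 2) ∞ γ) (hγo : IsOpen (range γ))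
    (e : X ≃ₜ (F × Circle) × Circle)
    (he : ContMDiff (𝓡 4) (((𝓡 2).prod (𝓡 1)).prod (𝓡 1)) ∞ e)
    (he' : ContMDiff (((𝓡 2).prod (𝓡 1)).prod (𝓡 1)) (𝓡 4) ∞ e.symm) (θ : Circle) :
    Manifold.IsSmoothEmbedding ((𝓡 2).prod (𝓡 2)) (𝓡 4) ∞
        (fun q : Rechart f₂ (Circle × Circle) × EuclideanSpace ℝ (Fin 2) =>
          e.symm ((γ ((Rechart.out f₂ (Circle × Circle) q.1).1,
              (q.2 0) • (EuclideanSpace.single 0 1 : EuclideanSpace ℝ (Fin 1))),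
            (Rechart.out f₂ (Circle × Circle) q.1).2), θ * Circle.exp (Real.arctan (q.2 1) / 2))) ∧
      IsOpen (range fun q : Rechart f₂ (Circle × Circle) × EuclideanSpace ℝ (Fin 2) =>
          e.symm ((γ ((Rechart.out f₂ (Circle × Circle) q.1).1,
              (q.2 0) • (EuclideanSpace.single 0 1 : EuclideanSpace ℝ (Fin 1))),
            (Rechart.out f₂ (Circle × Circle) q.1).2), θ * Circle.exp (Real.arctan (q.2 1) / 2))) ∧
      (range fun q : Rechart f₂ (Circle × Circle) × EuclideanSpace ℝ (Fin 2) =>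
          e.symm ((γ ((Rechart.out f₂ (Circle × Circle) q.1).1,
              (q.2 0) • (EuclideanSpace.single 0 1 : EuclideanSpace ℝ (Fin 1))),
            (Rechart.out f₂ (Circle × Circle) q.1).2), θ * Circle.exp (Real.arctan (q.2 1) / 2))) =
        {x | (e x).1.1 ∈ range γ ∧ 0 < ((((e x).2 * θ⁻¹ : Circle)) : ℂ).re ∧
          0 < (((((e x).2 * θ⁻¹ : Circle)) : ℂ) ^ 2).re} := by
  haveI hT : IsManifold (𝓡 2) ∞ (Rechart f₂ (Circle × Circle)) := Rechart.isManifold f₂ _ hf₂ hf₂'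
  haveI : Fact (Module.finrank ℝ ℂ = 1 + 1) := finrank_real_complex_fact'
  haveI : Nonempty (Circle × EuclideanSpace ℝ (Fin 1)) := ⟨(1, 0)⟩
  have hγi : Injective γ := hγ.isEmbedding.injective
  -- notation (bare functions)
  let arc : ℝ → Circle := fun t => θ * Circle.exp (Real.arctan t / 2)
  let ℓ : Circle → ℝ := fun z =>
    (((z * θ⁻¹ : Circle) : ℂ) ^ 2).im / (((z * θ⁻¹ : Circle) : ℂ) ^ 2).re
  let e₀ : EuclideanSpace ℝ (Fin 1) := EuclideanSpace.single 0 1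
  let u₀ : EuclideanSpace ℝ (Fin 2) := EuclideanSpace.single 0 1
  let u₁ : EuclideanSpace ℝ (Fin 2) := EuclideanSpace.single 1 1
  let toE : ℝ → ℝ → EuclideanSpace ℝ (Fin 2) := fun a b => a • u₀ + b • u₁
  have he₀ : ∀ u : EuclideanSpace ℝ (Fin 1), (u 0) • e₀ = u := fun u => by
    ext i
    fin_cases i
    simp [e₀]
  have he₀' : ∀ a : ℝ, (a • e₀) 0 = a := fun a => by simp [e₀]
  have htoE0 : ∀ a b, toE a b 0 = a := fun a b => by simp [toE, u₀, u₁]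
  have htoE1 : ∀ a b, toE a b 1 = b := fun a b => by simp [toE, u₀, u₁]
  have htoE : ∀ v : EuclideanSpace ℝ (Fin 2), toE (v 0) (v 1) = v := fun v => by
    ext i
    fin_cases i
    · exact htoE0 _ _
    · exact htoE1 _ _
  obtain ⟨harc_inj, harc_sm, harc_open⟩ :=
    injective_contMDiff_isOpenMap_mul_circleExp_arctan_half θ
  have hℓarc : ∀ t, ℓ (arc t) = t := fun t => by
    show (((θ * Circle.exp (Real.arctan t / 2) * θ⁻¹ : Circle) : ℂ) ^ 2).im /
        (((θ * Circle.exp (Real.arctan t / 2) * θ⁻¹ : Circle) : ℂ) ^ 2).re = t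
    rw [mul_inv_cancel_comm]
    exact im_sq_div_re_sq_circleExp_arctan_half t
  have harc_pos : ∀ t, 0 < (((arc t * θ⁻¹ : Circle)) : ℂ).re ∧
      0 < ((((arc t * θ⁻¹ : Circle)) : ℂ) ^ 2).re := fun t => by
    show 0 < (((θ * Circle.exp (Real.arctan t / 2) * θ⁻¹ : Circle) : ℂ)).re ∧
      0 < (((θ * Circle.exp (Real.arctan t / 2) * θ⁻¹ : Circle) : ℂ) ^ 2).re
    rw [mul_inv_cancel_comm]
    exact ⟨re_circleExp_arctan_half_pos _, re_sq_circleExp_arctan_half_pos _⟩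
  have harcℓ : ∀ z : Circle, 0 < (((z * θ⁻¹ : Circle)) : ℂ).re →
      0 < ((((z * θ⁻¹ : Circle)) : ℂ) ^ 2).re → arc (ℓ z) = z := fun z h₁ h₂ => by
    have hz : Circle.exp (Real.arctan (ℓ z) / 2) = z * θ⁻¹ := circleExp_arctan_half_eq h₁ h₂
    simp only [arc]
    rw [hz, mul_inv_cancel_comm_assoc]
  -- the tube on the product manifold and in `X`, and the left inverses
  let S : Rechart f₂ (Circle × Circle) × EuclideanSpace ℝ (Fin 2) → (F × Circle) × Circle :=
    fun q => ((γ ((Rechart.out f₂ (Circle × Circle) q.1).1, (q.2 0) • e₀),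
      (Rechart.out f₂ (Circle × Circle) q.1).2), arc (q.2 1))
  let TT : Rechart f₂ (Circle × Circle) × EuclideanSpace ℝ (Fin 2) → X := fun q => e.symm (S q)
  let Sinv : (F × Circle) × Circle → Rechart f₂ (Circle × Circle) × EuclideanSpace ℝ (Fin 2) :=
    fun y => (Rechart.into f₂ (Circle × Circle) ((invFun γ y.1.1).1, y.1.2),
      toE ((invFun γ y.1.1).2 0) (ℓ y.2))
  let finv : X → Rechart f₂ (Circle × Circle) × EuclideanSpace ℝ (Fin 2) := fun x => Sinv (e x)
  have hSleft : ∀ q, Sinv (S q) = q := by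
    rintro ⟨w, p⟩
    show (Rechart.into f₂ (Circle × Circle)
        ((invFun γ (γ ((Rechart.out f₂ (Circle × Circle) w).1, (p 0) • e₀))).1,
          (Rechart.out f₂ (Circle × Circle) w).2),
      toE ((invFun γ (γ ((Rechart.out f₂ (Circle × Circle) w).1, (p 0) • e₀))).2 0)
        (ℓ (arc (p 1)))) = (w, p)
    rw [leftInverse_invFun hγi]
    simp only [he₀', hℓarc, htoE, Prod.mk.eta, Rechart.into_out]
  have hleft : ∀ q, finv (TT q) = q := fun q => by
    show Sinv (e (e.symm (S q))) = q
    rw [Homeomorph.apply_symm_apply]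
    exact hSleft q
  have hinj : Injective TT := fun x y h => by rw [← hleft x, ← hleft y, h]
  -- smoothness of `S` and `TT`
  have hout₂ : ContMDiff (𝓡 2) ((𝓡 1).prod (𝓡 1)) ∞ (Rechart.out f₂ (Circle × Circle)) :=
    Rechart.contMDiff_out f₂ _ hf₂ hf₂'
  have hinto₂ : ContMDiff ((𝓡 1).prod (𝓡 1)) (𝓡 2) ∞ (Rechart.into f₂ (Circle × Circle)) :=
    Rechart.contMDiff_into f₂ _ hf₂ hf₂'
  have hproj2 : ∀ i : Fin 2, ContMDiff (𝓡 2) 𝓘(ℝ, ℝ) ∞ (fun v : EuclideanSpace ℝ (Fin 2) => v i) :=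
    fun i => (EuclideanSpace.proj (𝕜 := ℝ) (ι := Fin 2) i).contMDiff
  have hproj1 : ContMDiff (𝓡 1) 𝓘(ℝ, ℝ) ∞ (fun u : EuclideanSpace ℝ (Fin 1) => u 0) :=
    (EuclideanSpace.proj (𝕜 := ℝ) (ι := Fin 1) 0).contMDiff
  have hz₁ : ContMDiff ((𝓡 2).prod (𝓡 2)) (𝓡 1) ∞
      fun q : Rechart f₂ (Circle × Circle) × EuclideanSpace ℝ (Fin 2) =>
        (Rechart.out f₂ (Circle × Circle) q.1).1 :=
    contMDiff_fst.comp (hout₂.comp contMDiff_fst)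
  have hz₂ : ContMDiff ((𝓡 2).prod (𝓡 2)) (𝓡 1) ∞
      fun q : Rechart f₂ (Circle × Circle) × EuclideanSpace ℝ (Fin 2) =>
        (Rechart.out f₂ (Circle × Circle) q.1).2 :=
    contMDiff_snd.comp (hout₂.comp contMDiff_fst)
  have hp0 : ContMDiff ((𝓡 2).prod (𝓡 2)) (𝓡 1) ∞
      fun q : Rechart f₂ (Circle × Circle) × EuclideanSpace ℝ (Fin 2) => (q.2 0) • e₀ :=
    (((hproj2 0).comp contMDiff_snd).smul contMDiff_const)
  have hp1 : ContMDiff ((𝓡 2).prod (𝓡 2)) 𝓘(ℝ, ℝ) ∞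
      fun q : Rechart f₂ (Circle × Circle) × EuclideanSpace ℝ (Fin 2) => q.2 1 :=
    (hproj2 1).comp contMDiff_snd
  have hSsm : ContMDiff ((𝓡 2).prod (𝓡 2)) (((𝓡 2).prod (𝓡 1)).prod (𝓡 1)) ∞ S :=
    ((hγ.contMDiff.comp (hz₁.prodMk hp0)).prodMk hz₂).prodMk (harc_sm.comp hp1)
  have hTTsm : ContMDiff ((𝓡 2).prod (𝓡 2)) (𝓡 4) ∞ TT := he'.comp hSsm
  -- `S` (hence `TT`) is an open map: `S = (γ × id × arc) ∘ κ` for a homeomorphism `κ`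
  have hopenS : IsOpenMap S := by
    let πE₁ : EuclideanSpace ℝ (Fin 1) ≃ₜ ℝ :=
      (EuclideanSpace.equiv (Fin 1) ℝ).toHomeomorph.trans (Homeomorph.funUnique (Fin 1) ℝ)
    let πE₂ : EuclideanSpace ℝ (Fin 2) ≃ₜ ℝ × ℝ :=
      (EuclideanSpace.equiv (Fin 2) ℝ).toHomeomorph.trans (Homeomorph.piFinTwo fun _ => ℝ)
    have hπE₁ : ∀ u : EuclideanSpace ℝ (Fin 1), πE₁ u = u 0 := fun u => rfl
    have hπE₁' : ∀ a : ℝ, πE₁.symm a = a • e₀ := fun a => by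
      apply πE₁.injective
      rw [Homeomorph.apply_symm_apply, hπE₁, he₀']
    have hπE₂ : ∀ v : EuclideanSpace ℝ (Fin 2), πE₂ v = (v 0, v 1) := fun v => rfl
    let ρ : (Circle × Circle) × (ℝ × ℝ) ≃ₜ ((Circle × EuclideanSpace ℝ (Fin 1)) × Circle) × ℝ :=
    { toFun := fun q => (((q.1.1, πE₁.symm q.2.1), q.1.2), q.2.2)
      invFun := fun r => ((r.1.1.1, r.1.2), (πE₁ r.1.1.2, r.2))
      left_inv := fun q => by simp
      right_inv := fun r => by simp
      continuous_toFun := by fun_prop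
      continuous_invFun := by fun_prop }
    let κ : Rechart f₂ (Circle × Circle) × EuclideanSpace ℝ (Fin 2) ≃ₜ
        ((Circle × EuclideanSpace ℝ (Fin 1)) × Circle) × ℝ :=
      ((Rechart.outHomeomorph f₂ (Circle × Circle)).prodCongr πE₂).trans ρ
    have hS : S = Prod.map (Prod.map γ id) arc ∘ κ := by
      funext q
      show S q = Prod.map (Prod.map γ id) arc (ρ ((Rechart.outHomeomorph f₂ (Circle × Circle)) q.1,
        πE₂ q.2))
      rw [hπE₂, Rechart.coe_outHomeomorph]
      show S q = ((γ ((Rechart.out f₂ (Circle × Circle) q.1).1, πE₁.symm (q.2 0)),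
        (Rechart.out f₂ (Circle × Circle) q.1).2), arc (q.2 1))
      rw [hπE₁']
    rw [hS]
    have hγoe : Topology.IsOpenEmbedding γ := ⟨hγ.isEmbedding, hγo⟩
    exact ((hγoe.isOpenMap.prodMap IsOpenMap.id).prodMap harc_open).comp κ.isOpenMap
  have hopen : IsOpenMap TT := e.symm.isOpenMap.comp hopenS
  -- the range of `S`
  have hrangeS : ∀ y ∈ range S, y.1.1 ∈ range γ ∧ 0 < (((y.2 * θ⁻¹ : Circle)) : ℂ).re ∧
      0 < ((((y.2 * θ⁻¹ : Circle)) : ℂ) ^ 2).re := by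
    rintro _ ⟨⟨w, p⟩, rfl⟩
    exact ⟨⟨_, rfl⟩, harc_pos (p 1)⟩
  have hrangeTT : ∀ x ∈ range TT, e x ∈ range S := by
    rintro _ ⟨q, rfl⟩
    exact ⟨q, (e.apply_symm_apply (S q)).symm⟩
  -- the left inverse is smooth on the range
  have hcoe : ContMDiff (𝓡 1) 𝓘(ℝ, ℂ) ∞ (fun z : Circle => (z : ℂ)) := contMDiff_coe_sphere
  have hrot : ContMDiff (𝓡 1) (𝓡 1) ∞ (fun z : Circle => z * θ⁻¹) := contMDiff_mul_right
  have hℓ : ContMDiffOn (𝓡 1) 𝓘(ℝ, ℝ) ∞ ℓ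
      {z : Circle | 0 < ((((z * θ⁻¹ : Circle) : ℂ)) ^ 2).re} := by
    refine (contDiffOn_im_sq_div_re_sq.contMDiffOn.comp (hcoe.comp hrot).contMDiffOn ?_)
    intro z hz
    exact ne_of_gt hz
  have hγinv : ContMDiffOn (𝓡 2) ((𝓡 1).prod (𝓡 1)) ∞ (invFun γ) (range γ) :=
    Literature.Geometry.Manifold.contMDiffOn_invFun_range hγ
  have hA : ContMDiffOn (((𝓡 2).prod (𝓡 1)).prod (𝓡 1)) ((𝓡 1).prod (𝓡 1)) ∞
      (fun y : (F × Circle) × Circle => invFun γ y.1.1) (range S) :=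
    hγinv.comp (contMDiff_fst.comp contMDiff_fst).contMDiffOn fun y hy => (hrangeS y hy).1
  have hSinv : ContMDiffOn (((𝓡 2).prod (𝓡 1)).prod (𝓡 1)) ((𝓡 2).prod (𝓡 2)) ∞ Sinv (range S) := by
    refine ContMDiffOn.prodMk ?_ ?_
    · exact hinto₂.comp_contMDiffOn
        ((contMDiff_fst.comp_contMDiffOn hA).prodMk (contMDiff_snd.comp contMDiff_fst).contMDiffOn)
    · have h1 : ContMDiffOn (((𝓡 2).prod (𝓡 1)).prod (𝓡 1)) 𝓘(ℝ, ℝ) ∞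
          (fun y : (F × Circle) × Circle => (invFun γ y.1.1).2 0) (range S) :=
        hproj1.comp_contMDiffOn (contMDiff_snd.comp_contMDiffOn hA)
      have h2 : ContMDiffOn (((𝓡 2).prod (𝓡 1)).prod (𝓡 1)) 𝓘(ℝ, ℝ) ∞
          (fun y : (F × Circle) × Circle => ℓ y.2) (range S) :=
        hℓ.comp contMDiff_snd.contMDiffOn fun y hy => (hrangeS y hy).2.2
      exact (h1.smul contMDiffOn_const).add (h2.smul contMDiffOn_const)
  have hfinv : ContMDiffOn (𝓡 4) ((𝓡 2).prod (𝓡 2)) ∞ finv (range TT) :=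
    hSinv.comp he.contMDiffOn fun x hx => hrangeTT x hx
  -- conclusion
  let L : (EuclideanSpace ℝ (Fin 2) × EuclideanSpace ℝ (Fin 2)) ≃L[ℝ] EuclideanSpace ℝ (Fin 4) :=
    ContinuousLinearEquiv.ofFinrankEq (by simp)
  obtain ⟨hemb, hopenRange⟩ :=
    Literature.Geometry.Manifold.isSmoothEmbedding_of_leftInverse_of_isOpenMap
      (IY := (𝓡 2).prod (𝓡 2)) (I := 𝓡 4) hTTsm hinj hopen hfinv hleft L
  refine ⟨hemb, hopenRange, ?_⟩
  -- the range of `TT`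
  ext x
  constructor
  · intro hx
    exact hrangeS (e x) (hrangeTT x hx)
  · rintro ⟨⟨q₀, hq₀⟩, h₁, h₂⟩
    refine ⟨finv x, ?_⟩
    show e.symm (S (Sinv (e x))) = x
    rw [Homeomorph.symm_apply_eq]
    -- `S (Sinv y) = y` on the described set
    have hγy : γ (invFun γ (e x).1.1) = (e x).1.1 := invFun_eq ⟨q₀, hq₀⟩
    show ((γ ((Rechart.out f₂ (Circle × Circle)
        (Rechart.into f₂ (Circle × Circle) ((invFun γ (e x).1.1).1, (e x).1.2))).1,
          (toE ((invFun γ (e x).1.1).2 0) (ℓ (e x).2) 0) • e₀),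
        (Rechart.out f₂ (Circle × Circle)
          (Rechart.into f₂ (Circle × Circle) ((invFun γ (e x).1.1).1, (e x).1.2))).2),
      arc (toE ((invFun γ (e x).1.1).2 0) (ℓ (e x).2) 1)) = e x
    rw [Rechart.out_into, htoE0, htoE1, he₀, harcℓ (e x).2 h₁ h₂, Prod.mk.eta, hγy]

end TorusTube

end Literature.Topology.FourManifolds
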